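import Literature.AlgebraicGeometry.Resolution.LocalUniformizationAbhyankarPlaces
import Literature.AlgebraicGeometry.Resolution.LocalEtaleUniformization
import Literature.AlgebraicGeometry.Resolution.KnafKuhlmann2009Prop310
import Literature.AlgebraicGeometry.Resolution.ImmediateRationalUniformization
import HarnessLib

/-!
# The crux `Valuative.LuAlphaPTorsor` along the dense-Abhyankar range: the assembly
# (stmt-ResolutionOfSingularities-0641, line `pfaff-line-log-final-forms`, stub `stub_denseRangeAssembly`)

Knaf–Kuhlmann 2009 (H. Knaf, F.-V. Kuhlmann, *Every place admits local uniformization in a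
finite extension of the function field*, Adv. Math. 221 (2009) 428–453 = arXiv:math/0702856),
Thm. 1.5, first case: "if `F` lies in the completion of a subfunction field `F₀` on which `P` is
an Abhyankar place, then `P` is strongly smoothly `K`-uniformizable — no extension of `F` is
needed". This file proves the ASSEMBLY of that range in the vocabulary of the crux (relative
local uniformization: every finitely generated `S ⊆ O` is dominated by a finitely generated
`A ⊆ O` with `Frac A = K`, regular at the centre of `O`), MODULO four elementary inputs which
enter as hypotheses (the stubs D1–D4 of the line, in this order):

* D1 — density ⇒ the hypotheses of KK09 Lemma 3.9 (not used directly here: it is consumed by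
  the closed form of D3);
* D2 — density + a separable equation ⇒ a Hensel-root generator `η` of `L(w) = L(η)`;
* D3 — strong smooth `O_{K₀}`-uniformizability climbs a purely transcendental tower
  `F₀ ≤ F₀(y₁,…,y_s)` inside a field dense over `F₀` (closed form);
* D4 — the primitive element theorem for finitely many separable elements.

Chain (`stronglySmoothlyUniformizable_top_of_dense`): Knaf–Kuhlmann 2005 Thm. 1.1
(`KnafKuhlmann2005_Thm11_holds`) makes `F₀` strongly smoothly uniformizable over `K₀ = im k`,
transported to the base `O ∩ K₀ ≃ K₀` (`isSmoothlyUniformizableIn_inf_iff`); D3 climbs a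
separating transcendence basis `t` of `K | F₀` to `E = F₀(t)`; D4 writes `K = E(w)` with `w`
separable over `E`; if `w ∈ E` we are done, otherwise D2 replaces `w` by a Hensel root `η ∈ O`
of a monic polynomial over `O ∩ E` with unit derivative, KK09 Lemma 3.7 (2)
(`isSmoothlyUniformizableIn_of_henselRoot`) makes `K` strongly smoothly `O ∩ E`-uniformizable
and KK09 Cor. 3.6 (`knafKuhlmann2009_cor36`) composes. Finally
(`exists_regular_model_of_isSmoothlyUniformizableIn`, copied from
`relLU_at_abhyankarPlace`): the smooth model through the generators of `S` is improved to an
everywhere smooth normal model (`exists_normal_smooth_model`), re-read as a `k`-subalgebra, and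
is regular at the centre by EGA IV 17.5.8 (`Grothendieck1967_17_5_8.of_field`).
-/

-- single-problem summit: the doubled namespace component `ResolutionOfSingularities` is forced
set_option linter.dupNamespace false

open IsLocalRing

namespace Summit.ResolutionOfSingularities.ResolutionOfSingularities.Theorems.PfaffLine

open Literature.AlgebraicGeometry.Resolution

/-! ## From a smooth model over `im k` to a regular affine model (the bridge) -/

-- adapted from Literature/AlgebraicGeometry/Resolution/LocalUniformizationAbhyankarPlaces.lean
-- (`relLU_at_abhyankarPlace`, the tail after Knaf–Kuhlmann 2005 Thm. 1.1)
/-- **The smooth-to-regular bridge.** If the pair `(O, tS)` — `tS` a finite set of generators of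
the `k`-subalgebra `S` — is smoothly uniformizable over the field `K₀ = im k` on a model of `K`,
then `S` is dominated by a finitely generated `k`-subalgebra `A ⊆ O` with `Frac A = K` which is
regular at the centre of `O`: improve the model to an everywhere smooth one containing `tS`
(`exists_normal_smooth_model`), view it as a `k`-subalgebra, and apply EGA IV 17.5.8 over the
field `K₀` (`Grothendieck1967_17_5_8.of_field`). [folklore] -/
theorem exists_regular_model_of_isSmoothlyUniformizableIn {k K : Type} [Field k] [Field K]
    [Algebra k K] (O : ValuationSubring K) (S : Subalgebra k K) (tS : Finset K)
    (htS : Algebra.adjoin k (tS : Set K) = S)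
    (hSU : IsSmoothlyUniformizableIn (algebraMap k K).fieldRange O (⊤ : Subfield K) (tS : Set K)) :
    ∃ (A : Subalgebra k K) (h : A.toSubring ≤ O.toSubring), S ≤ A ∧ A.FG ∧ IsFractionRing A K ∧
      IsRegularLocalRing (Localization.AtPrime
        (Ideal.comap (Subring.inclusion h) (IsLocalRing.maximalIdeal O))) := by
  classical
  set K₀ : Subfield K := (algebraMap k K).fieldRange with hK₀
  -- an everywhere smooth model containing `tS`
  obtain ⟨B, hBO, -, hBfg, hBsm, -, htB, hfrac⟩ :=
    exists_normal_smooth_model Grothendieck1967_17_5_8_holds Matsumura1987_19_4_holds hSU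
  haveI := hBsm
  haveI : Algebra.FiniteType K₀ B := (Subalgebra.fg_iff_finiteType B).mp hBfg
  -- the same subring as a `k`-subalgebra
  let A : Subalgebra k K :=
    { B.toSubring.toSubsemiring with
      algebraMap_mem' := fun c => B.algebraMap_mem (⟨algebraMap k K c, c, rfl⟩ : K₀) }
  refine ⟨A, hBO, ?_, ?_, ?_, ?_⟩
  · -- `S ≤ A`
    rw [← htS]
    exact Algebra.adjoin_le fun z hz => htB hz
  · -- `A` is finitely generated over `k` (by the `K₀`-generators of `B`)
    obtain ⟨t₂, ht₂⟩ := hBfg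
    refine ⟨t₂, le_antisymm (Algebra.adjoin_le fun x hx => ?_) fun x hx => ?_⟩
    · change x ∈ B
      rw [← ht₂]
      exact Algebra.subset_adjoin hx
    · let T : Subalgebra K₀ K :=
        { (Algebra.adjoin k (t₂ : Set K)).toSubring.toSubsemiring with
          algebraMap_mem' := fun c => by
            obtain ⟨c', hc'⟩ := c.2
            change (c : K) ∈ Algebra.adjoin k (t₂ : Set K)
            rw [← hc']
            exact (Algebra.adjoin k (t₂ : Set K)).algebraMap_mem c' }
      have hBT : B ≤ T := by
        rw [← ht₂]
        exact Algebra.adjoin_le fun y hy => (Algebra.subset_adjoin hy : y ∈ Algebra.adjoin k _)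
      exact hBT hx
  · -- `Frac A = K`
    exact isFractionRing_of_forall_exists_div A.toSubring fun z => hfrac z trivial
  · -- regular at the centre: smooth over the field `K₀` (EGA IV 17.5.8)
    exact Grothendieck1967_17_5_8.of_field Grothendieck1967_17_5_8_holds K₀ B
      (centre B O hBO) (isSmoothAt_of_formallySmooth _)

/-! ## Small field-theoretic helpers -/

/-- The separable equation of an element `w` separable over an intermediate field `E`: its
minimal polynomial, mapped to the big field, has coefficients in `E`, vanishes at `w` and has
non-vanishing derivative at `w`. [folklore] -/
theorem exists_separable_equation {F K : Type} [Field F] [Field K] [Algebra F K]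
    (E : IntermediateField F K) {w : K} (hw : IsSeparable E w) :
    ∃ P : Polynomial K, (∀ n, P.coeff n ∈ E.toSubfield) ∧ P.eval w = 0 ∧
      (Polynomial.derivative P).eval w ≠ 0 := by
  refine ⟨(minpoly E w).map (algebraMap E K), fun n => ?_, ?_, ?_⟩
  · rw [Polynomial.coeff_map]
    exact ((minpoly E w).coeff n).2
  · rw [Polynomial.eval_map, ← Polynomial.aeval_def, minpoly.aeval]
  · rw [Polynomial.derivative_map, Polynomial.eval_map, ← Polynomial.aeval_def]
    exact Polynomial.Separable.aeval_derivative_ne_zero hw (minpoly.aeval E w)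

/-- If `k(s₀) = K` and `E(w) = E(s₀)` for an intermediate field `E` containing the image of `k`,
then `K = E(w)` as a subfield closure: `Subfield.closure (E ∪ {w}) = ⊤`. [folklore] -/
theorem closure_union_singleton_eq_top {k F K : Type} [Field k] [Field F] [Field K]
    [Algebra k K] [Algebra F K] (E : IntermediateField F K)
    (hkE : ∀ c : k, algebraMap k K c ∈ E) (s₀ : Finset K)
    (hs₀ : IntermediateField.adjoin k (s₀ : Set K) = ⊤) {w : K}
    (hw : IntermediateField.adjoin E ({w} : Set K) = IntermediateField.adjoin E (s₀ : Set K)) :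
    Subfield.closure ((E.toSubfield : Set K) ∪ {w}) = ⊤ := by
  have hr : Set.range (algebraMap E K) = (E.toSubfield : Set K) := by
    rw [IntermediateField.coe_toSubfield]
    exact Subtype.range_coe
  have h1 : (IntermediateField.adjoin E ({w} : Set K)).toSubfield =
      Subfield.closure ((E.toSubfield : Set K) ∪ {w}) := by
    rw [IntermediateField.adjoin_toSubfield, hr]
  rw [← h1, hw, eq_top_iff]
  intro z _
  have hz : z ∈ (IntermediateField.adjoin k (s₀ : Set K)).toSubfield := by
    rw [hs₀]
    trivial
  rw [IntermediateField.adjoin_toSubfield] at hz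
  refine Subfield.closure_le.mpr (Set.union_subset ?_ ?_) hz
  · rintro _ ⟨c, rfl⟩
    exact (IntermediateField.adjoin E (s₀ : Set K)).algebraMap_mem ⟨algebraMap k K c, hkE c⟩
  · exact IntermediateField.subset_adjoin E (s₀ : Set K)

/-- If `w ∈ E` and `Subfield.closure (E ∪ {w}) = ⊤`, then `E = ⊤`. [folklore] -/
theorem toSubfield_eq_top_of_mem {F K : Type} [Field F] [Field K] [Algebra F K]
    (E : IntermediateField F K) {w : K} (hwE : w ∈ E)
    (hgen : Subfield.closure ((E.toSubfield : Set K) ∪ {w}) = ⊤) : E.toSubfield = ⊤ := by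
  have h : Subfield.closure ((E.toSubfield : Set K) ∪ {w}) ≤ E.toSubfield :=
    Subfield.closure_le.mpr (Set.union_subset subset_rfl (Set.singleton_subset_iff.mpr hwE))
  rw [hgen] at h
  exact top_le_iff.mp h

/-! ## Strong smooth uniformizability of `K` over `O ∩ im k` (KK09 Thm. 1.5, first case) -/

/-- **Knaf–Kuhlmann 2009, Thm. 1.5, first case, valuation-theoretic core** (modulo D2, D3, D4):
if `K ⊇ F₀ ⊇ K₀`, `K₀ ⊆ O`, `F₀ | K₀` is finitely generated, `O` is an Abhyankar place of
`F₀ | K₀` with separably generated residue field extension, `K | F₀` is separably generated,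
`K | k` is finitely generated and `K` is dense in `F₀`, then for every finite `Z ⊆ O` the pair
`(O, Z)` is smoothly `O ∩ K₀`-uniformizable on a model of `K`. Chain: KK05 Thm. 1.1 on `F₀`;
D3 up the separating transcendence basis; D4 for a separable primitive element `w`; D2 for a
Hensel root; KK09 Lemma 3.7 (2) and Cor. 3.6. [cite: KnafKuhlmann2009, Thm. 1.5] -/
theorem stronglySmoothlyUniformizable_top_of_dense
    (h2 : ∀ (Ω : Type) [Field Ω] (V : ValuationSubring Ω) (L : Subfield Ω) (w : Ω), w ∉ L → (∃ P : Polynomial Ω, (∀ k, P.coeff k ∈ L) ∧ P.eval w = 0 ∧ (Polynomial.derivative P).eval w ≠ 0) → (∀ x ∈ Subfield.closure ((L : Set Ω) ∪ {w}), ∀ w' ∈ Subfield.closure ((L : Set Ω) ∪ {w}), w' ≠ 0 → ∃ a ∈ L, V.valuation (x - a) < V.valuation w') → ∃ η : Ω, η ∈ V ∧ Subfield.closure ((L : Set Ω) ∪ {η}) = Subfield.closure ((L : Set Ω) ∪ {w}) ∧ ∃ f : Polynomial Ω, f.Monic ∧ (∀ k, f.coeff k ∈ V ∧ f.coeff k ∈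 L) ∧ f.eval η = 0 ∧ V.valuation ((Polynomial.derivative f).eval η) = 1)
    (h3 : ∀ (Ω : Type) [Field Ω] (V : ValuationSubring Ω) (K₀ F₀ F : Subfield Ω) (s : ℕ) (y : Fin s → Ω), K₀ ≤ F₀ → F₀ ≤ F → (∀ i, y i ∈ F) → AlgebraicIndependent F₀ y → (∀ x ∈ F, ∀ w ∈ F, w ≠ 0 → ∃ a ∈ F₀, V.valuation (x - a) < V.valuation w) → (∀ Z : Finset Ω, (∀ z ∈ Z, z ∈ V ∧ z ∈ F₀) → IsSmoothlyUniformizableIn ↥(V.toSubring ⊓ K₀.toSubring) V F₀ (Z : Set Ω)) → ∀ Z : Finset Ω, (∀ z ∈ Z, z ∈ V ∧ z ∈ (IntermediateField.adjoin F₀ (Set.range y)).toSubfield) → IsSmoothlyUniformizableIn ↥(V.toSubring ⊓ K₀.toSubring) V (IntermediateField.adjoin F₀ (Set.range y)).toSubfield (Z : Set Ω))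
    (h4 : ∀ (F Ω : Type) [Field F] [Field Ω] [Algebra F Ω] (g : Finset Ω), (∀ x ∈ g, IsSeparable F x) → ∃ w : Ω, IsSeparable F w ∧ IntermediateField.adjoin F {w} = IntermediateField.adjoin F (g : Set Ω))
    {k K : Type} [Field k] [Field K] [Algebra k K] (O : ValuationSubring K)
    (hk : ∀ c : k, algebraMap k K c ∈ O) (htopfg : (⊤ : IntermediateField k K).FG)
    {F₀ : Subfield K} (hkF₀ : (algebraMap k K).fieldRange ≤ F₀)
    (hfgF₀ : FGOver (algebraMap k K).fieldRange F₀)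
    (hAbh : IsAbhyankarPlace O (algebraMap k K).fieldRange F₀)
    (hsepres : SeparablyGeneratedOver (resField O (algebraMap k K).fieldRange) (resField O F₀))
    (hsepgen : SeparablyGeneratedOver F₀ ⊤)
    (hdense : ∀ x w : K, w ≠ 0 → ∃ a ∈ F₀, O.valuation (x - a) < O.valuation w)
    (Z : Finset K) (hZ : ∀ z ∈ Z, z ∈ O ∧ z ∈ (⊤ : Subfield K)) :
    IsSmoothlyUniformizableIn ↥(O.toSubring ⊓ (algebraMap k K).fieldRange.toSubring) O ⊤
      (Z : Set K) := by
  classical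
  set K₀ : Subfield K := (algebraMap k K).fieldRange with hK₀
  have hK₀O : (K₀ : Set K) ⊆ O := by
    rintro x ⟨c, rfl⟩
    exact hk c
  -- (a) Knaf–Kuhlmann 2005 Thm. 1.1 on `F₀`, base transported to `O ∩ K₀`
  have hF₀SU : ∀ Z : Finset K, (∀ z ∈ Z, z ∈ O ∧ z ∈ F₀) →
      IsSmoothlyUniformizableIn ↥(O.toSubring ⊓ K₀.toSubring) O F₀ (Z : Set K) := fun Z hZ =>
    (isSmoothlyUniformizableIn_inf_iff O K₀ hK₀O F₀ _).mpr
      (KnafKuhlmann2005_Thm11_holds K O K₀ F₀ hkF₀ hfgF₀ hK₀O hAbh hsepres Z hZ)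
  -- (b) the separating transcendence basis `t`, `E = F₀(t)`
  obtain ⟨t, -, htai, hsep⟩ := hsepgen
  set E : IntermediateField F₀ K := IntermediateField.adjoin F₀ (t : Set K) with hE
  have hF₀E : ∀ x ∈ F₀, x ∈ E.toSubfield := fun x hx => E.algebraMap_mem ⟨x, hx⟩
  have hK₀E : K₀ ≤ E.toSubfield := fun x hx => hF₀E x (hkF₀ hx)
  have hESU : ∀ Z : Finset K, (∀ z ∈ Z, z ∈ O ∧ z ∈ E.toSubfield) →
      IsSmoothlyUniformizableIn ↥(O.toSubring ⊓ K₀.toSubring) O E.toSubfield (Z : Set K) := by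
    let y : Fin t.card → K := fun i => ((t.equivFin.symm i : t) : K)
    have hy : AlgebraicIndependent F₀ y := htai.comp _ t.equivFin.symm.injective
    have hrange : Set.range y = (t : Set K) := by
      ext x
      constructor
      · rintro ⟨i, rfl⟩
        exact (t.equivFin.symm i).2
      · intro hx
        exact ⟨t.equivFin ⟨x, hx⟩, by simp [y]⟩
    have h := h3 K O K₀ F₀ ⊤ t.card y hkF₀ le_top (fun _ => trivial) hy
      (fun x _ w _ hw => hdense x w hw) hF₀SU
    rw [hrange] at h
    exact h
  -- (c) a separable primitive element `w` of `K | E`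
  obtain ⟨s₀, hs₀⟩ := htopfg
  obtain ⟨w, hwsep, hw⟩ := h4 E K s₀ fun x _ => hsep x trivial
  have hkE : ∀ c : k, algebraMap k K c ∈ E := fun c => hK₀E ⟨c, rfl⟩
  have hgen : Subfield.closure ((E.toSubfield : Set K) ∪ {w}) = ⊤ :=
    closure_union_singleton_eq_top E hkE s₀ hs₀ hw
  -- (d) either `E = K`, or a Hensel root (D2) + Lemma 3.7 (2) + Cor. 3.6
  by_cases hwE : w ∈ E
  · have hEtop : E.toSubfield = ⊤ := toSubfield_eq_top_of_mem E hwE hgen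
    have h := hESU Z fun z hz => ⟨(hZ z hz).1, hEtop ▸ trivial⟩
    rw [hEtop] at h
    exact h
  · have hwE' : w ∉ E.toSubfield := fun h => hwE ((IntermediateField.mem_toSubfield _ _).mp h)
    obtain ⟨η, hηO, hηgen, f, hfmon, hfcoeff, hfη, hfder⟩ := h2 K O E.toSubfield w hwE'
      (exists_separable_equation E hwsep)
      (fun x _ w' _ hw' => by
        obtain ⟨a, haF₀, ha⟩ := hdense x w' hw'
        exact ⟨a, hF₀E a haF₀, ha⟩)
    have hF := isSmoothlyUniformizableIn_of_henselRoot O E.toSubfield ⊤ hηO (hηgen.trans hgen)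
      f hfmon hfcoeff hfη hfder
    exact knafKuhlmann2009_cor36 O hK₀E le_top hESU (fun Z hZ => hF Z hZ) Z hZ

/-! ## The stub -/

/-- Stub D5 (reshape v6.5): **assembly of the dense-Abhyankar range** — RELATIVE LOCAL
UNIFORMIZATION along every valuation ring `O ⊇ k` of a function field `K/k` such that `K` is
dense (for `v`) in a finitely generated subfield `F₀ ⊇ k` on which `O` is an Abhyankar place with
separably generated residue field extension, `K/F₀` separably generated (Knaf–Kuhlmann 2009,
Thm. 1.5, first case), MODULO D1–D4 (hypotheses, in this order): KK05 Thm. 1.1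
(`KnafKuhlmann2005_Thm11_holds`) makes `F₀` strongly smoothly `k`-uniformizable; D3 (fed with
D1) climbs a separating transcendence basis `t` of `K/F₀`; D4 writes `K = F₀(t)(w)` with `w`
separable over `F₀(t)`; D2 turns `w` into a Hensel root, so Lemma 3.7 (2)
(`isSmoothlyUniformizableIn_of_henselRoot`) and Cor. 3.6 (`knafKuhlmann2009_cor36`) make `K`
strongly smoothly `k`-uniformizable; finally `exists_normal_smooth_model` + EGA IV 17.5.8
(`Grothendieck1967_17_5_8.of_field`) give a finitely generated `A ⊇ S`, `A ⊆ O`, `Frac A = K`,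
regular at the centre (as in `relLU_at_abhyankarPlace`). [cite: KnafKuhlmann2009, Thm. 1.5] -/
theorem stub_denseRangeAssembly :
    (∀ (Ω : Type) [Field Ω] (V : ValuationSubring Ω) (L F : Subfield Ω) (z : Ω), L ≤ F → z ∈ F → (∀ x ∈ F, ∀ w ∈ F, w ≠ 0 → ∃ a ∈ L, V.valuation (x - a) < V.valuation w) → (∀ P : Polynomial Ω, (∀ k, P.coeff k ∈ L) → P.eval z = 0 → P = 0) → (∀ w ∈ Subfield.closure ((L : Set Ω) ∪ {z}), w ≠ 0 → ∃ b ∈ L, V.valuation w = V.valuation b) ∧ (∀ w ∈ Subfield.closure ((L : Set Ω) ∪ {z}), w ∈ V → ∃ c ∈ L, V.valuation (w - c) < 1) ∧ (∀ g : Polynomial Ω, (∀ k, g.coeff k ∈ L) → ∃ a₀ ∈ L, ∃ α : V.ValueGroup, ∀ a ∈ L, V.valuation (z - a) ≤ V.valuation (z - a₀) → V.valuation (g.eval a) = α)) →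
    (∀ (Ω : Type) [Field Ω] (V : ValuationSubring Ω) (L : Subfield Ω) (w : Ω), w ∉ L → (∃ P : Polynomial Ω, (∀ k, P.coeff k ∈ L) ∧ P.eval w = 0 ∧ (Polynomial.derivative P).eval w ≠ 0) → (∀ x ∈ Subfield.closure ((L : Set Ω) ∪ {w}), ∀ w' ∈ Subfield.closure ((L : Set Ω) ∪ {w}), w' ≠ 0 → ∃ a ∈ L, V.valuation (x - a) < V.valuation w') → ∃ η : Ω, η ∈ V ∧ Subfield.closure ((L : Set Ω) ∪ {η}) = Subfield.closure ((L : Set Ω) ∪ {w}) ∧ ∃ f : Polynomial Ω, f.Monic ∧ (∀ k, f.coeff k ∈ V ∧ f.coeff k ∈ L) ∧ f.eval η = 0 ∧ V.valuation ((Polynomial.derivative f).eval η) = 1) →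
    (∀ (Ω : Type) [Field Ω] (V : ValuationSubring Ω) (K₀ F₀ F : Subfield Ω) (s : ℕ) (y : Fin s → Ω), K₀ ≤ F₀ → F₀ ≤ F → (∀ i, y i ∈ F) → AlgebraicIndependent F₀ y → (∀ x ∈ F, ∀ w ∈ F, w ≠ 0 → ∃ a ∈ F₀, V.valuation (x - a) < V.valuation w) → (∀ Z : Finset Ω, (∀ z ∈ Z, z ∈ V ∧ z ∈ F₀) → Literature.AlgebraicGeometry.Resolution.IsSmoothlyUniformizableIn ↥(V.toSubring ⊓ K₀.toSubring) V F₀ (Z : Set Ω)) → ∀ Z : Finset Ω, (∀ z ∈ Z, z ∈ V ∧ z ∈ (IntermediateField.adjoin F₀ (Set.range y)).toSubfield) → Literature.AlgebraicGeometry.Resolution.IsSmoothlyUniformizableIn ↥(V.toSubring ⊓ K₀.toSubring) V (IntermediateField.adjoin F₀ (Set.range y)).toSubfield (Z : Set Ω)) →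
    (∀ (F Ω : Type) [Field F] [Field Ω] [Algebra F Ω] (g : Finset Ω), (∀ x ∈ g, IsSeparable F x) → ∃ w : Ω, IsSeparable F w ∧ IntermediateField.adjoin F {w} = IntermediateField.adjoin F (g : Set Ω)) →
    ∀ (k K : Type) [Field k] [Field K] [Algebra k K] (O : ValuationSubring K), (∀ c : k, algebraMap k K c ∈ O) → (⊤ : IntermediateField k K).FG → (∃ F₀ : Subfield K, (algebraMap k K).fieldRange ≤ F₀ ∧ Literature.AlgebraicGeometry.Resolution.FGOver (algebraMap k K).fieldRange F₀ ∧ Literature.AlgebraicGeometry.Resolution.IsAbhyankarPlace O (algebraMap k K).fieldRange F₀ ∧ Literature.AlgebraicGeometry.Resolution.SeparablyGeneratedOver (Literature.AlgebraicGeometry.Resolution.resField O (algebraMap k K).fieldRange) (Literature.AlgebraicGeometry.Resolution.resField O F₀) ∧ Literature.AlgebraicGeometry.Resolution.SeparablyGeneratedOver F₀ ⊤ ∧ ∀ x w : K, w ≠ 0 → ∃ a ∈ F₀, O.valuation (x - a) < O.valuation w) → ∀ (S : Subalgebra k K), S.FG → S.toSubring ≤ O.toSubring → ∃ (A : Subalgebra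 k K) (h : A.toSubring ≤ O.toSubring), S ≤ A ∧ A.FG ∧ IsFractionRing A K ∧ IsRegularLocalRing (Localization.AtPrime (Ideal.comap (Subring.inclusion h) (IsLocalRing.maximalIdeal O))) := by
  intro _ h2 h3 h4 k K _ _ _ O hk htopfg hF₀ S hSfg hSO
  obtain ⟨F₀, hkF₀, hfgF₀, hAbh, hsepres, hsepgen, hdense⟩ := hF₀
  classical
  have hK₀O : ((algebraMap k K).fieldRange : Set K) ⊆ O := by
    rintro x ⟨c, rfl⟩
    exact hk c
  -- generators of `S`: the finite set `Z`
  obtain ⟨tS, htS⟩ := hSfg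
  have htSS : (tS : Set K) ⊆ S := htS ▸ Algebra.subset_adjoin
  have hZ : ∀ z ∈ tS, z ∈ O ∧ z ∈ (⊤ : Subfield K) := fun z hz => ⟨hSO (htSS hz), trivial⟩
  -- KK09 Thm. 1.5 (first case): `(O, Z)` is smoothly `O ∩ K₀`-uniformizable, hence `K₀`-
  have hSU : IsSmoothlyUniformizableIn (algebraMap k K).fieldRange O (⊤ : Subfield K)
      (tS : Set K) :=
    (isSmoothlyUniformizableIn_inf_iff O _ hK₀O ⊤ _).mp
      (stronglySmoothlyUniformizable_top_of_dense h2 h3 h4 O hk htopfg hkF₀ hfgF₀ hAbh hsepres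
        hsepgen hdense tS hZ)
  exact exists_regular_model_of_isSmoothlyUniformizableIn O S tS htS hSU

end Summit.ResolutionOfSingularities.ResolutionOfSingularities.Theorems.PfaffLine
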